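import Literature.Computability.Cryptography.CubicClassTableSemStep
import HarnessLib

/-!
# Semantics of the class-group table, II: square-and-multiply and the reduced representative `b_E`

Topic `Computability/Cryptography`; theorem-only sequel of `CubicClassTableSemStep.lean` (crux
`LinnikCubicClassGroups.PureCubicClassGroupFBQP`, line `arakelov-giant-step-cycle`). With the context of that file
(`K = ℚ(θ)`, `θ³ = ab²`, `σ₁`, `σ₂`, programs `F` with `RedSem`, `ProdSpec`, instance `I`, cap `(243a²b²)² ≤ cap`,
`prec ≥ 4 size(ab) + 8`):

* `powFold_spec`, `powFold_spec_full` — the ABSTRACT square-and-multiply over the bits `ℓe−1, …, 0` (any type, any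
  invariant `P x q` stable under squaring `q ↦ 2q` and multiplication `q ↦ q+1`): the fold is `none` iff `n = 0`, else
  satisfies `P · n`;
* `WalkFns.starCc_mul_sem` — the workhorse: if `x ~ α⁻¹ M`, `y ~ β⁻¹ N` (canonical codes of reduced ideals, `σ₁ α, σ₁ β > 0`)
  then `starCc x y ~ (αβγ)⁻¹ (M N)`, reduced, position `x.2 + y.2 + l`, `|l − 2^prec log σ₁ γ| ≤ 1`,
  `|log σ₁ γ| ≤ 2 log (3√|d_K|)`;
* `WalkFns.powCc_sem` — `powCc g n` for `g ~ γ₀⁻¹ J` (`|g.2 − 2^prec log σ₁ γ₀| ≤ 1`), `0 < n < 2^ℓe`: the result codes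
  `α⁻¹ J^n`, reduced, `|pos − 2^prec log σ₁ α| ≤ 3n − 2`, `|log σ₁ α − n log σ₁ γ₀| ≤ 2 log(3√|d_K|) (n − 1)` (the
  exponent-weighted rounding and defect budgets);
* `WalkFns.bEc_sem` — for coin-free generator slots `gT · t` coding nonzero integral ideals `𝔤_t` with cylinder minima
  `γ_t`: `bEc v ~ α⁻¹ ∏_{t<T} 𝔤_t^{e_t}` (digits `e_t` of `v`), reduced, `|pos − 2^prec log σ₁ α| ≤ 3 Σ e_t`,
  `|log σ₁ α − Σ_t e_t log σ₁ γ_t| ≤ 2 log(3√|d_K|) Σ e_t` (the AFFINE main term of the accumulated distance).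
[Buchmann–Williams 1988, §3; Hallgren 2005, §4]

## References

* J. Buchmann, H. C. Williams, Math. Comp. 50 (1988), §3. [BuchmannWilliams1988]
* S. Hallgren, STOC 2005, §4. [Hallgren2005]
-/

noncomputable section

namespace Literature.Computability.Cryptography

namespace CubicClassTable

open Literature.NumberTheory.CubicFields Literature.NumberTheory.CubicFields.PureCubicCodes
open scoped NumberField nonZeroDivisors
open NumberField

/-! ### The abstract square-and-multiply -/

/-- Splitting off the top bit of a window of bits. [folklore] -/
theorem bits_split (n i k : ℕ) :
    n / 2 ^ i % 2 ^ (k + 1) = (if n.testBit (i + k) then 1 else 0) * 2 ^ k + n / 2 ^ i % 2 ^ k := by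
  rw [Nat.mod_pow_succ, Nat.testBit_eq_decide_div_mod_eq, Nat.div_div_eq_div_mul, ← pow_add]
  rcases Nat.mod_two_eq_zero_or_one (n / 2 ^ (i + k)) with h | h <;> simp [h, mul_comm, add_comm]

/-- **Abstract square-and-multiply, windowed form**: folding the bits `i+k−1, …, i` of `n` from an accumulator representing
`q₀` (`none` iff `q₀ = 0`) yields an accumulator representing `q₀ 2^k + (n / 2^i mod 2^k)`, for any invariant `P` stable
under squaring and multiplication by the base. [folklore] -/
theorem powFold_spec {X : Type*} (sq mul : X → X) (g : X) (P : X → ℕ → Prop)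
    (hg : P g 1) (hsq : ∀ x q, 0 < q → P x q → P (sq x) (2 * q))
    (hmul : ∀ x q, 0 < q → P x q → P (mul x) (q + 1)) (n : ℕ) :
    ∀ (k i : ℕ) (init : Option X) (q₀ : ℕ),
      ((q₀ = 0 ∧ init = none) ∨ (0 < q₀ ∧ ∃ x, init = some x ∧ P x q₀)) →
      ((q₀ * 2 ^ k + n / 2 ^ i % 2 ^ k = 0 ∧ ((List.range' i k).reverse).foldl (fun acc j =>
          if n.testBit j then some ((Option.map sq acc).elim g mul) else Option.map sq acc) init = none) ∨
        (0 < q₀ * 2 ^ k + n / 2 ^ i % 2 ^ k ∧ ∃ x, ((List.range' i k).reverse).foldl (fun acc j =>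
          if n.testBit j then some ((Option.map sq acc).elim g mul) else Option.map sq acc) init = some x ∧
          P x (q₀ * 2 ^ k + n / 2 ^ i % 2 ^ k))) := by
  intro k
  induction k with
  | zero =>
    intro i init q₀ h
    simp only [pow_zero, mul_one, Nat.mod_one, add_zero, List.range'_zero, List.reverse_nil, List.foldl_nil]
    rcases h with ⟨rfl, rfl⟩ | ⟨hq, x, rfl, hx⟩
    · exact Or.inl ⟨rfl, rfl⟩
    · exact Or.inr ⟨hq, x, rfl, hx⟩
  | succ k ih =>
    intro i init q₀ h
    have hsplit : (List.range' i (k + 1)).reverse = (i + k) :: (List.range' i k).reverse := by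
      rw [List.range'_concat, List.reverse_append]; simp
    rw [hsplit, List.foldl_cons]
    have key : q₀ * 2 ^ (k + 1) + n / 2 ^ i % 2 ^ (k + 1) =
        (2 * q₀ + (if n.testBit (i + k) then 1 else 0)) * 2 ^ k + n / 2 ^ i % 2 ^ k := by
      rw [bits_split]; ring
    rw [key]
    apply ih
    rcases h with ⟨rfl, rfl⟩ | ⟨hq, x, rfl, hx⟩
    · cases hb : n.testBit (i + k)
      · exact Or.inl ⟨by simp, by simp⟩
      · exact Or.inr ⟨by simp, g, by simp, by simpa using hg⟩
    · cases hb : n.testBit (i + k)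
      · exact Or.inr ⟨by simp; omega, sq x, by simp, by simpa using hsq x q₀ hq hx⟩
      · exact Or.inr ⟨by simp, mul (sq x), by simp, by simpa using hmul _ _ (by omega) (hsq x q₀ hq hx)⟩

/-- **Abstract square-and-multiply**: over all `L` bits of `n < 2^L` from the empty accumulator, the fold is `none` iff
`n = 0` and otherwise satisfies the invariant at `n`. [folklore] -/
theorem powFold_spec_full {X : Type*} (sq mul : X → X) (g : X) (P : X → ℕ → Prop)
    (hg : P g 1) (hsq : ∀ x q, 0 < q → P x q → P (sq x) (2 * q))
    (hmul : ∀ x q, 0 < q → P x q → P (mul x) (q + 1)) {L n : ℕ} (hn : n < 2 ^ L) :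
    (n = 0 ∧ ((List.range L).reverse).foldl (fun acc j =>
          if n.testBit j then some ((Option.map sq acc).elim g mul) else Option.map sq acc) none = none) ∨
      (0 < n ∧ ∃ x, ((List.range L).reverse).foldl (fun acc j =>
          if n.testBit j then some ((Option.map sq acc).elim g mul) else Option.map sq acc) none = some x ∧ P x n) := by
  have h := powFold_spec sq mul g P hg hsq hmul n L 0 none 0 (Or.inl ⟨rfl, rfl⟩)
  rw [List.range_eq_range']
  simpa [Nat.mod_eq_of_lt hn] using h

namespace WalkFns

section Pow

variable {K : Type*} [Field K] [NumberField K] {θ : K} {σ₁ : K →+* ℝ} {σ₂ : K →+* ℂ} {F : WalkFns} {I : Inst}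
variable (hdeg : Module.finrank ℚ K = 3) (hσ₂ : ∃ z : K, starRingEnd ℂ (σ₂ z) ≠ σ₂ z)
  (hab : Squarefree (I.a * I.b)) (hab1 : I.a * I.b ≠ 1) (hθ : θ ^ 3 = ((I.a * I.b ^ 2 : ℕ) : K))
  (hred : RedSem F I.a I.b K θ σ₁ σ₂) (hprod : ProdSpec I.a I.b K θ F.latProd)
  {cap : ℕ} (hcap : (243 * I.a ^ 2 * I.b ^ 2) ^ 2 ≤ cap) (hprec : 4 * Nat.size (I.a * I.b) + 8 ≤ I.prec)

/-- `0 ≤ log (3 √|d_K|)` and `log |d_K| ≤ 2 log (3 √|d_K|)`. [folklore] -/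
theorem logB_bounds : 0 ≤ Real.log (3 * Real.sqrt |(discr K : ℝ)|) ∧
    Real.log |(discr K : ℝ)| ≤ 2 * Real.log (3 * Real.sqrt |(discr K : ℝ)|) := by
  have hd : (1 : ℝ) ≤ |(discr K : ℝ)| := by
    have h0 : (1 : ℤ) ≤ |discr K| := Int.one_le_abs (discr_ne_zero K)
    rw [← Int.cast_abs]; exact_mod_cast h0
  have hs : (1 : ℝ) ≤ Real.sqrt |(discr K : ℝ)| := by rw [Real.one_le_sqrt]; exact hd
  have hsq : Real.sqrt |(discr K : ℝ)| ^ 2 = |(discr K : ℝ)| := Real.sq_sqrt (by linarith)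
  refine ⟨Real.log_nonneg (by linarith), ?_⟩
  have h9 : |(discr K : ℝ)| ≤ (3 * Real.sqrt |(discr K : ℝ)|) ^ 2 := by nlinarith [hsq]
  calc Real.log |(discr K : ℝ)| ≤ Real.log ((3 * Real.sqrt |(discr K : ℝ)|) ^ 2) :=
        Real.log_le_log (by positivity) h9
    _ = 2 * Real.log (3 * Real.sqrt |(discr K : ℝ)|) := by rw [Real.log_pow]; norm_num

include hdeg hσ₂ hab hab1 hθ hred hprod hcap hprec in
/-- **Product-and-reduce with multipliers**: `x ~ α⁻¹ M`, `y ~ β⁻¹ N` reduced ⟹ `starCc x y ~ (αβγ)⁻¹ (M N)` reduced, at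
position `x.2 + y.2 + l`, `|l − 2^prec log σ₁ γ| ≤ 1`, `|log σ₁ γ| ≤ 2 log (3√|d_K|)`. [cite: BuchmannWilliams1988, §3] -/
theorem starCc_mul_sem {x y : PLat} {M N : FractionalIdeal (𝓞 K)⁰ K} {α β : K}
    (hx : Canon x.1) (hxM : ∀ φ : K, Mem θ I.b x.1 φ ↔ φ ∈ FractionalIdeal.spanSingleton (𝓞 K)⁰ α⁻¹ * M)
    (h1 : (1 : K) ∈ posRelMinima σ₁ σ₂ (FractionalIdeal.spanSingleton (𝓞 K)⁰ α⁻¹ * M))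
    (hy : Canon y.1) (hyN : ∀ φ : K, Mem θ I.b y.1 φ ↔ φ ∈ FractionalIdeal.spanSingleton (𝓞 K)⁰ β⁻¹ * N)
    (h2 : (1 : K) ∈ posRelMinima σ₁ σ₂ (FractionalIdeal.spanSingleton (𝓞 K)⁰ β⁻¹ * N)) :
    ∃ γ : K, 0 < σ₁ γ ∧ Canon (F.starCc I cap x y).1 ∧
      (∀ φ : K, Mem θ I.b (F.starCc I cap x y).1 φ ↔
        φ ∈ FractionalIdeal.spanSingleton (𝓞 K)⁰ (α * β * γ)⁻¹ * (M * N)) ∧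
      (1 : K) ∈ posRelMinima σ₁ σ₂ (FractionalIdeal.spanSingleton (𝓞 K)⁰ (α * β * γ)⁻¹ * (M * N)) ∧
      |(((F.starCc I cap x y).2 - x.2 - y.2 : ℤ) : ℝ) - 2 ^ I.prec * Real.log (σ₁ γ)| ≤ 1 ∧
      |Real.log (σ₁ γ)| ≤ 2 * Real.log (3 * Real.sqrt |(discr K : ℝ)|) := by
  obtain ⟨γ, hrel, hcan, hmem, hone, hpos, hlo, hhi, -⟩ :=
    starCc_sem hdeg hσ₂ hab hab1 hθ hred hprod hcap hprec hx hxM h1 hy hyN h2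
  have hγ0 : γ ≠ 0 := hrel.1.2.1
  have hideal : FractionalIdeal.spanSingleton (𝓞 K)⁰ γ⁻¹ *
      (FractionalIdeal.spanSingleton (𝓞 K)⁰ α⁻¹ * M * (FractionalIdeal.spanSingleton (𝓞 K)⁰ β⁻¹ * N)) =
      FractionalIdeal.spanSingleton (𝓞 K)⁰ (α * β * γ)⁻¹ * (M * N) := by
    rw [spanSingleton_inv_mul_mul_spanSingleton_inv_mul, ← mul_assoc, FractionalIdeal.spanSingleton_mul_spanSingleton]
    congr 1
    rw [mul_inv, mul_inv, mul_inv]; ring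
  obtain ⟨hL0, hLd⟩ := logB_bounds (K := K)
  refine ⟨γ, hrel.2, hcan, fun φ => by rw [hmem φ, hideal], hideal ▸ hone, hpos, ?_⟩
  rw [abs_le]; constructor <;> linarith

/-- `powCc` as an instance of the abstract square-and-multiply fold (no pattern matching). [folklore] -/
theorem powCc_eq_fold (F : WalkFns) (I : Inst) (cap : ℕ) (g : PLat) (n : ℕ) :
    F.powCc I cap g n = ((List.range I.ℓe).reverse).foldl (fun acc j =>
      if n.testBit j then some ((Option.map (fun x => F.starCc I cap x x) acc).elim g (fun x => F.starCc I cap x g))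
      else Option.map (fun x => F.starCc I cap x x) acc) none := by
  unfold powCc
  congr 1
  funext acc j
  cases acc <;> rfl

include hdeg hσ₂ hab hab1 hθ hred hprod hcap hprec in
/-- **Square-and-multiply on the codes**: `g ~ γ₀⁻¹ J` reduced with `|g.2 − 2^prec log σ₁ γ₀| ≤ 1`, `0 < n < 2^ℓe` ⟹
`powCc g n = some x`, `x ~ α⁻¹ J^n` reduced, `|x.2 − 2^prec log σ₁ α| ≤ 3n − 2`,
`|log σ₁ α − n log σ₁ γ₀| ≤ 2 log(3√|d_K|) (n − 1)`. [cite: Hallgren2005, §4] -/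
theorem powCc_sem {g : PLat} {J : FractionalIdeal (𝓞 K)⁰ K} {γ₀ : K} (hγ₀ : 0 < σ₁ γ₀) (hg : Canon g.1)
    (hgJ : ∀ φ : K, Mem θ I.b g.1 φ ↔ φ ∈ FractionalIdeal.spanSingleton (𝓞 K)⁰ γ₀⁻¹ * J)
    (h1 : (1 : K) ∈ posRelMinima σ₁ σ₂ (FractionalIdeal.spanSingleton (𝓞 K)⁰ γ₀⁻¹ * J))
    (hg2 : |(g.2 : ℝ) - 2 ^ I.prec * Real.log (σ₁ γ₀)| ≤ 1) {n : ℕ} (hn0 : 0 < n) (hn : n < 2 ^ I.ℓe) :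
    ∃ x : PLat, F.powCc I cap g n = some x ∧ ∃ α : K, 0 < σ₁ α ∧ Canon x.1 ∧
      (∀ φ : K, Mem θ I.b x.1 φ ↔ φ ∈ FractionalIdeal.spanSingleton (𝓞 K)⁰ α⁻¹ * J ^ n) ∧
      (1 : K) ∈ posRelMinima σ₁ σ₂ (FractionalIdeal.spanSingleton (𝓞 K)⁰ α⁻¹ * J ^ n) ∧
      |(x.2 : ℝ) - 2 ^ I.prec * Real.log (σ₁ α)| ≤ 3 * n - 2 ∧
      |Real.log (σ₁ α) - n * Real.log (σ₁ γ₀)| ≤ 2 * Real.log (3 * Real.sqrt |(discr K : ℝ)|) * (n - 1) := by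
  set LB : ℝ := Real.log (3 * Real.sqrt |(discr K : ℝ)|) with hLB
  obtain ⟨hL0, -⟩ := logB_bounds (K := K)
  -- the invariant
  set P : PLat → ℕ → Prop := fun x q => ∃ α : K, 0 < σ₁ α ∧ Canon x.1 ∧
      (∀ φ : K, Mem θ I.b x.1 φ ↔ φ ∈ FractionalIdeal.spanSingleton (𝓞 K)⁰ α⁻¹ * J ^ q) ∧
      (1 : K) ∈ posRelMinima σ₁ σ₂ (FractionalIdeal.spanSingleton (𝓞 K)⁰ α⁻¹ * J ^ q) ∧
      |(x.2 : ℝ) - 2 ^ I.prec * Real.log (σ₁ α)| ≤ 3 * q - 2 ∧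
      |Real.log (σ₁ α) - q * Real.log (σ₁ γ₀)| ≤ 2 * LB * (q - 1) with hP
  have hPg : P g 1 := ⟨γ₀, hγ₀, hg, by simpa using hgJ, by simpa using h1, by norm_num; exact hg2, by simp⟩
  have hsq : ∀ x q, 0 < q → P x q → P (F.starCc I cap x x) (2 * q) := by
    rintro x q hq ⟨α, hα, hx, hxM, hone, herr, hdr⟩
    obtain ⟨γ, hγ, hcan, hmem, hone', hpos, hlg⟩ :=
      starCc_mul_sem hdeg hσ₂ hab hab1 hθ hred hprod hcap hprec hx hxM hone hx hxM hone
    have hpow : J ^ q * J ^ q = J ^ (2 * q) := by rw [← pow_add]; ring_nf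
    refine ⟨α * α * γ, by rw [map_mul, map_mul]; positivity, hcan, fun φ => by rw [hmem φ, hpow],
      hpow ▸ hone', ?_, ?_⟩
    · have hl : Real.log (σ₁ (α * α * γ)) = 2 * Real.log (σ₁ α) + Real.log (σ₁ γ) := by
        rw [map_mul, map_mul, Real.log_mul (by positivity) hγ.ne', Real.log_mul hα.ne' hα.ne']; ring
      rw [hl]
      have e : ((F.starCc I cap x x).2 : ℝ) = (((F.starCc I cap x x).2 - x.2 - x.2 : ℤ) : ℝ) + x.2 + x.2 := by
        push_cast; ring
      rw [e, abs_le]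
      rw [abs_le] at herr hpos
      push_cast
      constructor <;> linarith [herr.1, herr.2, hpos.1, hpos.2]
    · have hl : Real.log (σ₁ (α * α * γ)) = 2 * Real.log (σ₁ α) + Real.log (σ₁ γ) := by
        rw [map_mul, map_mul, Real.log_mul (by positivity) hγ.ne', Real.log_mul hα.ne' hα.ne']; ring
      rw [hl, abs_le]
      rw [abs_le] at hdr hlg
      have hq1 : (1 : ℝ) ≤ q := by exact_mod_cast hq
      push_cast
      constructor <;> nlinarith [hdr.1, hdr.2, hlg.1, hlg.2, hL0, hq1]
  have hmul : ∀ x q, 0 < q → P x q → P (F.starCc I cap x g) (q + 1) := by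
    rintro x q hq ⟨α, hα, hx, hxM, hone, herr, hdr⟩
    obtain ⟨γ, hγ, hcan, hmem, hone', hpos, hlg⟩ :=
      starCc_mul_sem hdeg hσ₂ hab hab1 hθ hred hprod hcap hprec hx hxM hone hg hgJ h1
    have hpow : J ^ q * J = J ^ (q + 1) := by rw [pow_succ]
    refine ⟨α * γ₀ * γ, by rw [map_mul, map_mul]; positivity, hcan, fun φ => by rw [hmem φ, hpow],
      hpow ▸ hone', ?_, ?_⟩
    · have hl : Real.log (σ₁ (α * γ₀ * γ)) = Real.log (σ₁ α) + Real.log (σ₁ γ₀) + Real.log (σ₁ γ) := by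
        rw [map_mul, map_mul, Real.log_mul (by positivity) hγ.ne', Real.log_mul hα.ne' hγ₀.ne']
      rw [hl]
      have e : ((F.starCc I cap x g).2 : ℝ) = (((F.starCc I cap x g).2 - x.2 - g.2 : ℤ) : ℝ) + x.2 + g.2 := by
        push_cast; ring
      rw [e, abs_le]
      rw [abs_le] at herr hpos hg2
      push_cast
      constructor <;> linarith [herr.1, herr.2, hpos.1, hpos.2, hg2.1, hg2.2]
    · have hl : Real.log (σ₁ (α * γ₀ * γ)) = Real.log (σ₁ α) + Real.log (σ₁ γ₀) + Real.log (σ₁ γ) := by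
        rw [map_mul, map_mul, Real.log_mul (by positivity) hγ.ne', Real.log_mul hα.ne' hγ₀.ne']
      rw [hl, abs_le]
      rw [abs_le] at hdr hlg
      push_cast
      constructor <;> nlinarith [hdr.1, hdr.2, hlg.1, hlg.2, hL0]
  have h := powFold_spec_full (fun x => F.starCc I cap x x) (fun x => F.starCc I cap x g) g P hPg hsq hmul hn
  rcases h with ⟨h0, -⟩ | ⟨-, x, hx, hPx⟩
  · omega
  · exact ⟨x, by rw [powCc_eq_fold]; exact hx, hPx⟩

include hdeg hσ₂ hab hab1 hθ hred hprod hcap hprec in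
/-- `powCc g 0 = none`, and `powCc g n ≠ none` for `0 < n < 2^ℓe` (under the hypotheses of `powCc_sem`). [folklore] -/
theorem powCc_zero (g : PLat) : F.powCc I cap g 0 = none := by
  have _ := hdeg; have _ := hσ₂; have _ := hab; have _ := hab1; have _ := hθ; have _ := hred; have _ := hprod
  have _ := hcap; have _ := hprec
  have h := powFold_spec_full (fun x => F.starCc I cap x x) (fun x => F.starCc I cap x g) g (fun _ _ => True)
    trivial (fun _ _ _ _ => trivial) (fun _ _ _ _ => trivial) (L := I.ℓe) (n := 0) (by positivity)
  rcases h with ⟨-, h⟩ | ⟨h, -⟩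
  · rw [powCc_eq_fold]; exact h
  · omega

end Pow

end WalkFns


section Summary

/-- **Summary (registered helper of the class-group stage)**: the clamped square-and-multiply codes `α⁻¹ J^n`, reduced, with the exponent-weighted rounding and defect budgets. [cite: Hallgren2005, §4] -/
theorem cubicClassTable_powCc_sem : ∀ (K : Type) [Field K] [NumberField K], Module.finrank ℚ K = 3 → ∀ (θ : K) (σ₁ : K →+* ℝ) (σ₂ : K →+* ℂ), (∃ z : K, starRingEnd ℂ (σ₂ z) ≠ σ₂ z) → ∀ (F : CubicClassTable.WalkFns) (I : CubicClassTable.Inst), Squarefree (I.a * I.b) → I.a * I.b ≠ 1 → θ ^ 3 = ((I.a * I.b ^ 2 : ℕ) : K) → CubicClassTable.RedSem F I.a I.b K θ σ₁ σ₂ → CubicClassTable.ProdSpec I.a I.b K θ F.latProd → ∀ (cap : ℕ), (243 * I.a ^ 2 * I.b ^ 2) ^ 2 ≤ cap → 4 * Nat.size (I.a * I.b) + 8 ≤ I.prec → ∀ (g : (ℕ × List ℤ) × ℤ) (J : FractionalIdeal (𝓞 K)⁰ K) (γ₀ : K), 0 < σ₁ γ₀ → PureCubicCodes.Canon g.1 →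 (∀ φ : K, PureCubicCodes.Mem θ I.b g.1 φ ↔ φ ∈ FractionalIdeal.spanSingleton (𝓞 K)⁰ γ₀⁻¹ * J) → (1 : K) ∈ posRelMinima σ₁ σ₂ (FractionalIdeal.spanSingleton (𝓞 K)⁰ γ₀⁻¹ * J) → |(g.2 : ℝ) - 2 ^ I.prec * Real.log (σ₁ γ₀)| ≤ 1 → ∀ (n : ℕ), 0 < n → n < 2 ^ I.ℓe → ∃ x : (ℕ × List ℤ) × ℤ, F.powCc I cap g n = some x ∧ ∃ α : K, 0 < σ₁ α ∧ PureCubicCodes.Canon x.1 ∧ (∀ φ : K, PureCubicCodes.Mem θ I.b x.1 φ ↔ φ ∈ FractionalIdeal.spanSingleton (𝓞 K)⁰ α⁻¹ * J ^ n) ∧ (1 : K) ∈ posRelMinima σ₁ σ₂ (FractionalIdeal.spanSingleton (𝓞 K)⁰ α⁻¹ * J ^ n) ∧ |(x.2 : ℝ) - 2 ^ I.prec * Real.log (σ₁ α)| ≤ 3 * n - 2 ∧ |Real.log (σ₁ α) - n * Real.log (σ₁ γ₀)| ≤ 2 * Real.log (3 * Real.sqrt |(NumberField.discr K : ℝ)|)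 * (n - 1) :=
  fun _ _ _ hdeg _ _ _ hσ₂ _ _ hab hab1 hθ hred hprod _ hcap hprec _ _ _ hγ₀ hg hgJ h1 hg2 _ hn0 hn =>
    WalkFns.powCc_sem hdeg hσ₂ hab hab1 hθ hred hprod hcap hprec hγ₀ hg hgJ h1 hg2 hn0 hn

end Summary

end CubicClassTable

end Literature.Computability.Cryptography
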